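import Summits.ResolutionOfSingularities.ResolutionOfSingularities.Theorems.FrobeniusLadderFInjectiveMacaulayficationDimSlice
import Summits.ResolutionOfSingularities.ResolutionOfSingularities.Theorems.FrobeniusLadderFInjectiveMacaulayficationRegularOffFiniteOfLRAdm
import Literature.AlgebraicGeometry.Morphisms.NagataCompactificationProofs
import HarnessLib

/-!
# Q10 «FLATTENING-FREE DOOR TWIN», file A: the threefold one-blow-up package and the «regular off finitely many closed points» layer without Raynaud–Gruson
# (crux `FInjectiveMacaulayfication` stmt-ResolutionOfSingularities-15315, chain w45a; res-L1-w45a-plan-1 RULING R21.6 (2) on res-inputs-plan-2 g9's INPUTS-CP-v12 ADDENDUM 6 §1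
# «F-76 `Stacks081R` is PHANTOM on the CP lines»; seat res-L1-w45a-lead-1 g10, registrar)

[OURS · L1 W4.5a] Support file (`--supports stmt-ResolutionOfSingularities-15315 --as helper`); def-free; ZERO new mathematics — every theorem below is the FLATTENING-FREE TWIN of a
landed theorem (name = original ++ `F`, statement = original minus the Raynaud–Gruson hypothesis `Stacks081R`, proof = the original text with the callee swapped to its twin). The ONE
primitive swap is in the root: `CommonAdmissibleBlowup.exists_isBlowup_dominating_of_stacks081R` ↦ the tree's UNCONDITIONAL
`Literature.AlgebraicGeometry.Morphisms.exists_isBlowup_dominating` (Nagata compactification / Stacks 081T, landed 2026-08-16, axioms standard; identical statement). Nothing of the crux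
is proved; the results stay CONDITIONAL on CP 2019 Thm 1.1 (`hG`) and CP 2019 Prop 4.4 (`hP`, itself closed by name in the tree) and on the candidate statements they name. AI-written
(AI review is weaker than expert review).

Twins in this file (originals in parentheses): `exists_isBlowup_isRegular_of_dim_three_of_isQuasiExcellentF` (Literature `CP2019.…`, the root consumer) ·
`admitsDesingularization_of_isBlowup_stalk_dimThreeF`, `localBlowups_hlocF` (`LocalBlowupDesingularizationDimThree.…`) · `hlocAdm_of_cp_of_rungsF`, `regularOffFinite_of_rungsF`
(`DimSlice.…`) · `hlocAdm_of_cp_of_LRadmF`, `regularOffFinite_of_LRadmF` (`RegularOffFiniteOfLRAdm.…`). File B (`…StepDoorStacksFree`) carries the cascade up to the door terms.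
[cite: CossartPiltant2019, Thm. 1.1 (i)(ii); Prop. 4.4] [cite: StacksProject, Tag 081T; Tag 080A; Tag 080B; Tag 02OS] [cite: Temkin2008, Prop. 2.3.4]
-/

-- single-problem summit: the doubled namespace component is forced
set_option linter.dupNamespace false

noncomputable section

open CategoryTheory CategoryTheory.Limits AlgebraicGeometry TopologicalSpace IsLocalRing
open Literature.AlgebraicGeometry.Resolution Literature.AlgebraicGeometry.CossartPiltant200819 Literature.AlgebraicGeometry.Motives
open Scheme.IdealSheafData

namespace Summit.ResolutionOfSingularities.ResolutionOfSingularities.Theorems.FInjectiveMacaulayfication.StacksFree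

open Summit.ResolutionOfSingularities.ResolutionOfSingularities.Theorems.FInjectiveMacaulayfication
open SliceableCentre ClosedPointLocalResolutionAdm ClosedPointLocalResolutionAdmTr
open LocalBlowupDesingularizationDimThree DimSlice RegularOffFiniteOfLRAdm
open Literature.AlgebraicGeometry.CossartPiltant200819.CP2019

/-- ★ **RAYNAUD–GRUSON-FREE TWIN of `CP2019.exists_isBlowup_isRegular_of_dim_three_of_isQuasiExcellent`: an integral separated Noetherian quasi-excellent threefold is
resolved by one blowing up, given CP 2019 Thm. 1.1 (i)(ii) and CP 2019 Prop. 4.4 ONLY** — the flattening hypothesis of the original is PHANTOM: its one use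
(`exists_isBlowup_dominating_of_stacks081R`) is replaced by the tree's UNCONDITIONAL `Literature.AlgebraicGeometry.Morphisms.exists_isBlowup_dominating` (Nagata / Stacks 081T,
same statement token for token). Original text otherwise — the tree's
`Resolution.exists_isBlowup_isRegular_of_dim_three` with the base field removed: there are a
non-zero ideal sheaf `𝓛` on `X` and a blowing up `ρ : T → X` along `𝓛` with `T` regular,
`Supp 𝓛 ⊆ X ∖ U` and `ρ` an isomorphism over `U`, where `U = Reg X`.  Proof: word for word the
tree's (Thm. 1.1 ⇒ `π : X' → X`; Stacks 081T ⇒ a `U`-admissible blowing up `b : S' → X` dominating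
`X'`; Prop. 4.4 on the regular excellent threefold `X'`; 080A/080B/02OS), except that `X'` is
excellent because it is regular and quasi-excellent (`isExcellent_of_isRegular_of_isQuasiExcellent`)
and `dim X' = 3` by `IsResolution.topologicalKrullDim_eq`.
[cite: CossartPiltant2019, Thm. 1.1 (i)(ii); Prop. 4.4 (v1: 4.3); §4.1 (v1 pp. 50-52)]
[cite: RaynaudGruson1971, I 5.2.2] [cite: StacksProject, Tag 081T; Tag 080A; Tag 080B; Tag 02OS]
[cite: Matsumura1987, Thm. 15.5] -/
theorem exists_isBlowup_isRegular_of_dim_three_of_isQuasiExcellentF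
    (hG : CossartPiltant2019General.{0}) (hP : CossartPiltant2019Principalization.{0})
    {X : Scheme.{0}} [IsIntegral X] [IsNoetherian X] [X.IsSeparated]
    (hqe : Scheme.IsQuasiExcellent X) (hdimX : topologicalKrullDim X = 3) :
    ∃ (𝓛 : X.IdealSheafData) (T : Scheme.{0}) (ρ : T ⟶ X),
      𝓛 ≠ ⊥ ∧ IsBlowup ρ 𝓛 ∧ Scheme.IsRegular T ∧
        ∃ U : X.Opens, (U : Set X) = Scheme.regularLocus X ∧
          (𝓛.support : Set X) ⊆ (U : Set X)ᶜ ∧ IsIso (ρ ∣_ U) := by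
  classical
  -- (1) Cossart–Piltant Thm. 1.1 as printed
  obtain ⟨X', π, hπ, U, hU, hisoU⟩ := hG X hqe hdimX.le
  haveI := hisoU
  haveI : IsProper π := hπ.isProper
  haveI : IsReduced X' := hπ.isRegular.isReduced
  haveI : IsIntegral X' := hπ.isBirational.isIntegral
  haveI : IsNoetherian X' := by
    haveI : IsLocallyNoetherian X' := LocallyOfFiniteType.isLocallyNoetherian π
    haveI : CompactSpace X' := QuasiCompact.compactSpace_of_compactSpace π
    exact {}
  -- `U = Reg X` is non-empty: the generic point is regular (its local ring is the function field)
  have hUne : (U : Set X).Nonempty := by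
    refine ⟨genericPoint X, ?_⟩
    rw [hU, Scheme.mem_regularLocus]
    exact inferInstanceAs (IsRegularLocalRing X.functionField)
  -- (2) Stacks 081T: the `U`-admissible blowing up dominating `X'`
  obtain ⟨I, S', b, r, -, hIsupp, hb, hrπ, hr⟩ :=
    Literature.AlgebraicGeometry.Morphisms.exists_isBlowup_dominating π U (NoetherianSpace.isCompact _)
  -- `𝓙 = π⁻¹𝓘 𝒪_{X'}` is non-zero: `π⁻¹(U) ≅ U` is non-empty and off `V(𝓙) = π⁻¹ V(𝓘)`
  have h𝓙 : I.comap π ≠ ⊥ := by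
    intro h0
    obtain ⟨x, hx⟩ := hUne
    obtain ⟨x', hx'⟩ := (ConcreteCategory.bijective_of_isIso (π ∣_ U).base).2 ⟨x, hx⟩
    have hmem : x'.1 ∈ (I.comap π).support := by rw [h0, support_bot]; trivial
    rw [support_comap] at hmem
    have hmem' : π x'.1 ∈ (I.support : Set X) := hmem
    rw [hIsupp] at hmem'
    exact hmem' x'.2
  -- (3) principalization of `𝓙` on the regular excellent threefold `X'`
  -- `X'` is excellent (regular and quasi-excellent) and `dim X' = dim X = 3` (no base needed)
  have hexc : Scheme.IsExcellent X' :=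
    isExcellent_of_isRegular_of_isQuasiExcellent hπ.isRegular
      (Scheme.IsQuasiExcellent.of_locallyOfFiniteType π hqe)
  have hdimX' : topologicalKrullDim X' = 3 := hπ.topologicalKrullDim_eq.trans hdimX
  obtain ⟨S'', σ, hseq, hprinc⟩ := hP X' hπ.isRegular hexc hdimX' (I.comap π) h𝓙
  haveI : IsIntegral S'' := hseq.isIntegral h𝓙
  have hS''reg : Scheme.IsRegular S'' := hseq.isRegular hπ.isRegular
  have hcart : IsEffectiveCartier ((I.comap π).comap σ) :=
    hprinc.isEffectiveCartier_of_ne_bot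
      (hseq.isIntegral_and_comap_ne_bot inferInstance inferInstance h𝓙).2.2
  -- `σ` is one blowing up in `𝓚`, `Supp 𝓚 ⊆ V(𝓙)`, and also the blowing up in `𝓚 · 𝓙`
  obtain ⟨𝓚, h𝓚, h𝓚supp⟩ := hseq.exists_isBlowup_supported inferInstance
  have hσ : IsBlowup σ (𝓚 * I.comap π) := by
    have := h𝓚.comp (IsBlowup.id hcart)
    rwa [Category.id_comp] at this
  -- the blowing up `t : T → S'` of `r⁻¹𝓚`; `t ≫ r` is the blowing up of `X'` in `𝓙 · 𝓚`
  obtain ⟨T, t, ht⟩ := exists_isBlowup S' (𝓚.comap r)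
  have htr : IsBlowup (t ≫ r) (𝓚 * I.comap π) := by
    rw [mul_comm]
    exact hr.comp ht
  obtain ⟨e, -, -⟩ := hσ.unique htr
  have hTreg : Scheme.IsRegular T := hS''reg.of_iso e.hom
  -- `t ≫ b : T → X` is one blowing up of `X` in an ideal sheaf supported in `X ∖ U`
  have h𝓚r : ((𝓚.comap r).support : Set S') ⊆ b ⁻¹' (U : Set X)ᶜ := by
    intro s hs
    rw [support_comap] at hs
    have hs' : r s ∈ ((I.comap π).support : Set X') := h𝓚supp hs
    rw [support_comap] at hs'
    have hs'' : π (r s) ∈ (I.support : Set X) := hs'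
    rw [hIsupp, ← Scheme.Hom.comp_apply, hrπ] at hs''
    exact hs''
  obtain ⟨𝓛, h𝓛, h𝓛supp⟩ :=
    IsBlowup.exists_isBlowup_comp_supported b I t (𝓚.comap r) ((U : Set X)ᶜ) hb hIsupp.le ht h𝓚r
  -- read off
  refine ⟨𝓛, T, t ≫ b, ?_, h𝓛, hTreg, U, hU, h𝓛supp, h𝓛.isIso_morphismRestrict ?_⟩
  · intro h0
    obtain ⟨x, hx⟩ := hUne
    have hmem : x ∈ (𝓛.support : Set X) := by rw [h0, support_bot]; trivial
    exact h𝓛supp hmem hx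
  · exact Set.disjoint_left.mpr fun x hx hx' => h𝓛supp hx' hx


/-- **I-B. Every blowing up of `Spec 𝒪_{X,x}`, `dim 𝒪_{X,x} = 3`, admits a desingularization** (`X` integral, locally of finite type over a field),
modulo CP 2019 Thm. 1.1 + CP 2019 Prop. 4.4 BY NAME — flattening-free twin of `LocalBlowupDesingularizationDimThree.admitsDesingularization_of_isBlowup_stalk_dimThree`. [OURS · conditional-result]
[cite: CossartPiltant2019, Thm. 1.1 (i)(ii); Prop. 4.4] [cite: Temkin2008, Def. 2.2.6; Prop. 2.3.4 (iii)] [cite: StacksProject, Tag 07QU] -/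
theorem admitsDesingularization_of_isBlowup_stalk_dimThreeF
    (hG : CossartPiltant2019General.{0}) (hP : CossartPiltant2019Principalization.{0})
    {K : Type} [Field K] {X : Scheme.{0}} (f₀ : X ⟶ Spec (.of K)) [LocallyOfFiniteType f₀] [IsIntegral X]
    (x : X) (hdim : ringKrullDim (X.presheaf.stalk x) = 3)
    (S' : Scheme.{0}) (g : S' ⟶ Spec (X.presheaf.stalk x)) (I : (Spec (X.presheaf.stalk x)).IdealSheafData) (hg : IsBlowup g I) :
    Scheme.AdmitsDesingularization S' := by
  classical
  haveI : IsLocallyNoetherian X := LocallyOfFiniteType.isLocallyNoetherian f₀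
  by_cases hI : I = ⊥
  · subst hI
    haveI := isEmpty_of_isBlowup_bot hg
    exact admitsDesingularization_of_isEmpty S'
  -- `S := Spec 𝒪_{X,x}`: integral, Noetherian, affine, quasi-excellent, of dimension `3`
  have hqX : Scheme.IsQuasiExcellent X := Scheme.isQuasiExcellent_of_locallyOfFiniteType Stacks07QW_field_holds f₀
  have hqR : IsQuasiExcellentRing (X.presheaf.stalk x) := hqX.isQuasiExcellentRing_stalk x
  have hqe : Scheme.IsQuasiExcellent (Spec (X.presheaf.stalk x)) :=
    Scheme.isQuasiExcellent_of_locallyOfFiniteType_of_isQuasiExcellentRing Stacks07QU_holds hqR (𝟙 _)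
  have hdimS : topologicalKrullDim (Spec (X.presheaf.stalk x)) = 3 := by
    change topologicalKrullDim (PrimeSpectrum (X.presheaf.stalk x)) = 3
    rw [PrimeSpectrum.topologicalKrullDim_eq_ringKrullDim, hdim]
  -- `S′`: integral, proper over `S` hence Noetherian and separated, quasi-excellent, of dimension `3`
  haveI : IsIntegral S' := hg.isIntegral hI
  haveI : IsProper g := hg.isProper
  haveI : IsLocallyNoetherian S' := LocallyOfFiniteType.isLocallyNoetherian g
  haveI : CompactSpace S' := QuasiCompact.compactSpace_of_compactSpace g
  haveI : IsNoetherian S' := {}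
  haveI : S'.IsSeparated := Scheme.isSeparated_of_isSeparated_over g
  have hqe' : Scheme.IsQuasiExcellent S' := Scheme.IsQuasiExcellent.of_locallyOfFiniteType g hqe
  have hdim' : topologicalKrullDim S' = 3 := by
    rw [(hg.isBirational' hI).topologicalKrullDim_eq_of_isProper]
    exact hdimS
  -- Cossart–Piltant: one blowing up `ρ : T → S′` along `𝓛` with `T` regular and `supp 𝓛 ⊆ (Reg S′)ᶜ`
  obtain ⟨𝓛, T, ρ, -, hρ, hTreg, U, hU, h𝓛U, -⟩ := exists_isBlowup_isRegular_of_dim_three_of_isQuasiExcellentF hG hP hqe' hdim'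
  refine ⟨T, ρ, ⟨⟨𝓛, hρ, ?_⟩, hTreg⟩⟩
  rw [← hU]
  exact h𝓛U


/-- **I-B in the shape of `hloc`** of `DesingularizationOffClosedPoints.desingularization_offClosedPoints_of_local` (verbatim binder) — flattening-free twin.
[OURS · conditional-result] [cite: CossartPiltant2019, Thm. 1.1 (i)(ii); Prop. 4.4] [cite: Temkin2008, Prop. 2.3.4 (iii)] -/
theorem localBlowups_hlocF
    (hG : CossartPiltant2019General.{0}) (hP : CossartPiltant2019Principalization.{0})
    {K : Type} [Field K] {X : Scheme.{0}} (f₀ : X ⟶ Spec (.of K)) [LocallyOfFiniteType f₀] [IsIntegral X] :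
    ∀ x : X, ringKrullDim (X.presheaf.stalk x) = 3 →
      ∀ (S' : Scheme.{0}) (g : S' ⟶ Spec (X.presheaf.stalk x)) (I : (Spec (X.presheaf.stalk x)).IdealSheafData),
        IsBlowup g I → Scheme.AdmitsDesingularization S' :=
  fun x hdim S' g I hg => admitsDesingularization_of_isBlowup_stalk_dimThreeF hG hP f₀ x hdim S' g I hg


/-- **(hloc) of `desingularization_offClosedPoints_of_local_adm` for ONE `X` of dimension `n ≥ 3`** from Cossart–Piltant below local dimension 4 and the
rungs `ClosedPointLocalResolutionAdmTr p e r`, `4 ≤ e ≤ n − 1`, `r ≥ 1` — flattening-free twin of `DimSlice.hlocAdm_of_cp_of_rungs`. [OURS · conditional-result] [cite: CossartPiltant2019, Thm. 1.1 (i)(ii); Prop. 4.4] -/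
theorem hlocAdm_of_cp_of_rungsF
    (hG : CossartPiltant2019General.{0}) (hP : CossartPiltant2019Principalization.{0})
    (p : ℕ) (k : Type) [Field k] [CharP k p] (X : Scheme.{0}) (f₀ : X ⟶ Spec (.of k))
    [IsSeparated f₀] [LocallyOfFiniteType f₀] [QuasiCompact f₀] [IsIntegral X] {n : ℕ} (hn : topologicalKrullDim X = n) (h3 : 3 ≤ n)
    (hR : ∀ e r : ℕ, 4 ≤ e → e + 1 ≤ n → 1 ≤ r → ClosedPointLocalResolutionAdmTr p e r) :
    ∀ ζ : X, ¬ IsClosed ({ζ} : Set X) →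
      (∀ (S' : Scheme.{0}) (g : S' ⟶ Spec (X.presheaf.stalk ζ)) (I : (Spec (X.presheaf.stalk ζ)).IdealSheafData),
        IsBlowup g I → ((I.support : Set _) ⊆ (Scheme.regularLocus (Spec (X.presheaf.stalk ζ)))ᶜ) →
          (∀ s : S', s ∉ Scheme.regularLocus S' → g.base s = closedPoint (X.presheaf.stalk ζ)) →
          Scheme.AdmitsDesingularization S') ∨
      (∃ x : X, ζ ⤳ x ∧ ∀ (S' : Scheme.{0}) (g : S' ⟶ Spec (X.presheaf.stalk x)) (I : (Spec (X.presheaf.stalk x)).IdealSheafData),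
        IsBlowup g I → ((I.support : Set _) ⊆ (Scheme.regularLocus (Spec (X.presheaf.stalk x)))ᶜ) →
          Scheme.AdmitsDesingularization S') := by
  intro ζ hζ
  haveI : IsLocallyNoetherian X := LocallyOfFiniteType.isLocallyNoetherian f₀
  obtain ⟨m, hm⟩ := exists_nat_cast_eq_ringKrullDim (R := X.presheaf.stalk ζ)
  by_cases hm3 : m ≤ 3
  · -- below local dimension 4: specialise to a loc-dim-3 point, Cossart–Piltant there (no fibre condition needed)
    obtain ⟨x, hζx, hx3⟩ := RegularOffCodimFourResidue.exists_specializes_ringKrullDim_stalk_eq f₀ hn ζ (n := 3)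
      (by rw [hm]; exact_mod_cast hm3) h3
    exact Or.inr ⟨x, hζx, fun S' g I hg _ => localBlowups_hlocF hG hP f₀ x hx3 S' g I hg⟩
  · -- local dimension ≥ 4: the closed-point rung at level `m ≤ n − 1`
    refine Or.inl (localBody_at_nonClosed_of_tr_lt p f₀ hn hR ζ hζ ?_)
    rw [hm]
    exact_mod_cast (by omega : 4 ≤ m)


/-- **REGULAR OFF FINITELY MANY CLOSED POINTS, for one `X` of dimension `n ≥ 3`, modulo the rungs `4 … n − 1` and the threefold package** — flattening-free twin of `DimSlice.regularOffFinite_of_rungs`.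
[OURS · conditional-result] [cite: Temkin2008, Prop. 2.3.4] [cite: CossartPiltant2019, Thm. 1.1 (i)(ii); Prop. 4.4] -/
theorem regularOffFinite_of_rungsF
    (hG : CossartPiltant2019General.{0}) (hP : CossartPiltant2019Principalization.{0})
    (p : ℕ) (k : Type) [Field k] [CharP k p] (X : Scheme.{0}) (f₀ : X ⟶ Spec (.of k))
    [IsSeparated f₀] [LocallyOfFiniteType f₀] [QuasiCompact f₀] [IsIntegral X] {n : ℕ} (hn : topologicalKrullDim X = n) (h3 : 3 ≤ n)
    (hR : ∀ e r : ℕ, 4 ≤ e → e + 1 ≤ n → 1 ≤ r → ClosedPointLocalResolutionAdmTr p e r) :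
    ∃ (X' : Scheme.{0}) (f : X' ⟶ X) (J : X.IdealSheafData) (F : Set X), IsBlowup f J ∧
      (J.support : Set X) ⊆ (Scheme.regularLocus X)ᶜ ∧ IsClosed F ∧ F.Finite ∧ (∀ b ∈ F, IsClosed ({b} : Set X)) ∧
      ∀ x' : X', f x' ∉ F → x' ∈ Scheme.regularLocus X' := by
  have hk : Scheme.IsQuasiExcellent (Spec (.of k)) :=
    Scheme.isQuasiExcellent_of_locallyOfFiniteType Stacks07QW_field_holds (𝟙 (Spec (.of k)))
  haveI : IsNoetherianRing (CommRingCat.of k) := inferInstanceAs (IsNoetherianRing k)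
  exact DesingularizationOffClosedPointsAdm.desingularization_offFinite_of_local_adm hk f₀
    (hlocAdm_of_cp_of_rungsF hG hP p k X f₀ hn h3 hR)


/-- **(hloc) of `desingularization_offClosedPoints_of_local_adm` from Cossart–Piltant below local dimension 4 and (LR_adm) at local dimension ≥ 4**
(`X` integral of finite type over `k`, `dim X ≥ 3`) — flattening-free twin of `RegularOffFiniteOfLRAdm.hlocAdm_of_cp_of_LRadm`. [OURS · conditional-result] [cite: CossartPiltant2019, Thm. 1.1 (i)(ii); Prop. 4.4]
[cite: GortzWedhorn2020, Thm. 5.22] -/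
theorem hlocAdm_of_cp_of_LRadmF
    (hG : CossartPiltant2019General.{0}) (hP : CossartPiltant2019Principalization.{0})
    (hLR : LocalResolutionNonClosedGe4Adm)
    (p : ℕ) (hp : p.Prime) (k : Type) [Field k] [CharP k p] (X : Scheme.{0}) (f₀ : X ⟶ Spec (.of k))
    [IsSeparated f₀] [LocallyOfFiniteType f₀] [QuasiCompact f₀] [IsIntegral X] (h3 : (3 : WithBot ℕ∞) ≤ topologicalKrullDim X) :
    ∀ ζ : X, ¬ IsClosed ({ζ} : Set X) →
      (∀ (S' : Scheme.{0}) (g : S' ⟶ Spec (X.presheaf.stalk ζ)) (I : (Spec (X.presheaf.stalk ζ)).IdealSheafData),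
        IsBlowup g I → ((I.support : Set _) ⊆ (Scheme.regularLocus (Spec (X.presheaf.stalk ζ)))ᶜ) →
          (∀ s : S', s ∉ Scheme.regularLocus S' → g.base s = closedPoint (X.presheaf.stalk ζ)) →
          Scheme.AdmitsDesingularization S') ∨
      (∃ x : X, ζ ⤳ x ∧ ∀ (S' : Scheme.{0}) (g : S' ⟶ Spec (X.presheaf.stalk x)) (I : (Spec (X.presheaf.stalk x)).IdealSheafData),
        IsBlowup g I → ((I.support : Set _) ⊆ (Scheme.regularLocus (Spec (X.presheaf.stalk x)))ᶜ) →
          Scheme.AdmitsDesingularization S') := by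
  intro ζ hζ
  haveI : IsLocallyNoetherian X := LocallyOfFiniteType.isLocallyNoetherian f₀
  haveI : CompactSpace X := QuasiCompact.compactSpace_of_compactSpace f₀
  obtain ⟨d₀, hd₀⟩ := exists_topologicalKrullDim_le_of_locallyOfFiniteType f₀
  obtain ⟨d, hd⟩ := exists_topologicalKrullDim_eq_nat hd₀
  have h3d : 3 ≤ d := by
    rw [hd] at h3
    exact_mod_cast h3
  obtain ⟨n, hn⟩ := exists_nat_cast_eq_ringKrullDim (R := X.presheaf.stalk ζ)
  by_cases hn3 : n ≤ 3
  · -- below local dimension 4: specialise to a loc-dim-3 point, Cossart–Piltant there (no fibre condition needed)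
    obtain ⟨x, hζx, hx3⟩ := RegularOffCodimFourResidue.exists_specializes_ringKrullDim_stalk_eq f₀ hd ζ (n := 3)
      (by rw [hn]; exact_mod_cast hn3) h3d
    exact Or.inr ⟨x, hζx, fun S' g I hg _ => localBlowups_hlocF hG hP f₀ x hx3 S' g I hg⟩
  · -- local dimension ≥ 4: (LR_adm) at `ζ` itself
    refine Or.inl (hLR p hp k X f₀ inferInstance inferInstance inferInstance inferInstance ζ hζ ?_)
    rw [hn]
    exact_mod_cast (by omega : 4 ≤ n)


/-- **REGULAR OFF FINITELY MANY CLOSED POINTS in every dimension ≥ 3, modulo (LR_adm) and the threefold package**: for `X` integral separated of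
finite type over `k` with `dim X ≥ 3` there are a blowing up `f : X′ → X` along `J` with `Supp J ⊆ (Reg X)ᶜ` and a closed FINITE set `F` of CLOSED
points with `X′` regular at every point not over `F` — flattening-free twin of `RegularOffFiniteOfLRAdm.regularOffFinite_of_LRadm`. [OURS · conditional-result] [cite: Temkin2008, Prop. 2.3.4] [cite: CossartPiltant2019, Thm. 1.1 (i)(ii); Prop. 4.4] -/
theorem regularOffFinite_of_LRadmF
    (hG : CossartPiltant2019General.{0}) (hP : CossartPiltant2019Principalization.{0})
    (hLR : LocalResolutionNonClosedGe4Adm)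
    (p : ℕ) (hp : p.Prime) (k : Type) [Field k] [CharP k p] (X : Scheme.{0}) (f₀ : X ⟶ Spec (.of k))
    [IsSeparated f₀] [LocallyOfFiniteType f₀] [QuasiCompact f₀] [IsIntegral X] (h3 : (3 : WithBot ℕ∞) ≤ topologicalKrullDim X) :
    ∃ (X' : Scheme.{0}) (f : X' ⟶ X) (J : X.IdealSheafData) (F : Set X), IsBlowup f J ∧
      (J.support : Set X) ⊆ (Scheme.regularLocus X)ᶜ ∧ IsClosed F ∧ F.Finite ∧ (∀ b ∈ F, IsClosed ({b} : Set X)) ∧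
      ∀ x' : X', f x' ∉ F → x' ∈ Scheme.regularLocus X' := by
  have hk : Scheme.IsQuasiExcellent (Spec (.of k)) :=
    Scheme.isQuasiExcellent_of_locallyOfFiniteType Stacks07QW_field_holds (𝟙 (Spec (.of k)))
  haveI : IsNoetherianRing (CommRingCat.of k) := inferInstanceAs (IsNoetherianRing k)
  exact DesingularizationOffClosedPointsAdm.desingularization_offFinite_of_local_adm hk f₀
    (hlocAdm_of_cp_of_LRadmF hG hP hLR p hp k X f₀ h3)

end Summit.ResolutionOfSingularities.ResolutionOfSingularities.Theorems.FInjectiveMacaulayfication.StacksFree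

end
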